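import Mathlib
import Literature.Computability.AlgebraicComplexity.NestFreeMatchingPoly
import Summits.ValiantsHypothesis.ValiantsHypothesis.Theorems.DivisionGapPerCofactorDegreeReductionStubMonomialStripping
import Summits.ValiantsHypothesis.ValiantsHypothesis.Theorems.DivisionGapPerCofactorDegreeReductionStubContentSplit
import Summits.ValiantsHypothesis.ValiantsHypothesis.Theorems.DivisionGapZeroOneTransferSplit
import Summits.ValiantsHypothesis.ValiantsHypothesis.Theses.FifoMatching
import HarnessLib

/-!
# Route FifoMatching — crux `NNDivisionHard` (stmt-ValiantsHypothesis-21181): MONOMIAL CONTENT IS USELESS —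
# the crux is its CONTENT-FREE tier, by name

A certificate `(h, NN_n · h)` whose cofactor has monomial content `x^M` (`h = x^M · h₂`, `h₂` content-free: every variable is
missed by some monomial of `h₂` — the tree's `ContentSplit.exists_content_split`) can be replaced by the certificate
`(h₂, NN_n · h₂)` at POLYNOMIAL cost, WHATEVER the degree of `x^M` (which may be `2^{L₊}`): Jukna–Seiwert–Sergeev's contraction,
in the tree as `MonomialStripping.complexity_le_of_monomial_mul` (`L₊(q) ≤ 16 ((N+1)(L₊(x^D q)+1))²` in `N × N` variables),
applied to `q = NN_n · h₂` and to `q = h₂` (`N = 2n`).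

* `complexity_strip_le` — the two polynomial bounds `L₊(NN_n·h₂) ≤ 16((2n+1)(L₊(NN_n·h)+1))²`, `L₊(h₂) ≤ 16((2n+1)(L₊(h)+1))²`
  for `h = x^M · h₂`;
* `strip_arith` — the absorption `32 ((2n+1)(2^{(ℓ+c)^c}+1))² ≤ 2^{2(ℓ+c)^c + 2ℓ + 11}`, `ℓ = log₂ n`;
* ★ `nnDivisionHard_iff_contentFreeTier` — **`NNDivisionHard` ⟺ for every `c`, eventually in `n`, every nonzero CONTENT-FREE
  cofactor `h` (every arc variable is missed by some monomial of `h`) has `2^((log₂ n + c)^c) < L₊(NN_n · h) + L₊(h)`**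
  (quasi-polynomial bookkeeping by `DivisionGapZeroOneTransfer.Split.qp_absorb`).

Consequences.  The hyper-degree enemies of 21181 of the form `x^M · q` with `q` of moderate degree are NOT enemies (strip, then
the degree rungs R2 / R2-exp apply to `q`); in particular the support item HD-1 `NNMonomialCofactorHard` (`h = x^e`, closed
through the polyhedral K1 chain) also follows elementarily from `NNMonotoneExpBound` by stripping.  Together with the landed
tiers (torus-homogeneous, hyper-degree, cheap; window-dense / deep / spread; unsaturated — `…UnsaturatedTier`), the open
residual of 21181 consists of cheap, content-free, torus-homogeneous cofactors of degree `> 2^{⌊n^{1/8}⌋}` missing some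
nest-free perfect matching.  (The normalisations do not commute for free: the top vertex-component of a content-free cofactor
may acquire content, and each strip squares the cost, so only boundedly many alternations are quasi-polynomial.)

HONEST FRAMING: by-name bookkeeping over a landed engine (JSS contraction); `NNDivisionHard`, `NNNotVP`, VP ≠ VNP remain OPEN
(NOT proved).  References: S. Jukna, H. Seiwert, I. Sergeev, *Reciprocal inputs in arithmetic and tropical circuits*, ECCC
TR20-178 / 2022, Thm 1 [JuknaSeiwertSergeev2022]; Hrubeš–Yehudayoff 2021 §6 Problem 2, Prop 43(3) [HrubesYehudayoff2021].
-/

noncomputable section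

-- Sub = Summit single-conjunct layout: the duplicated namespace component is mandated by the tree.
set_option linter.dupNamespace false
set_option autoImplicit false

namespace Summit.ValiantsHypothesis.ValiantsHypothesis.Theorems.FifoMatching.NNDivisionHard.ContentFree

open MvPolynomial Literature.Computability.AlgebraicComplexity
open Summit.ValiantsHypothesis.ValiantsHypothesis.Theorems.DivisionGap.PerCofactorDegreeReduction.MonomialStripping
  (complexity_le_of_monomial_mul)
open Summit.ValiantsHypothesis.ValiantsHypothesis.Theorems.DivisionGap.PerCofactorDegreeReduction.ContentSplit
  (exists_content_split)
open Summit.ValiantsHypothesis.ValiantsHypothesis.Theorems.DivisionGapZeroOneTransfer.Split (qp_absorb)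
open scoped NNReal BigOperators Classical

/-- **Stripping the monomial content of a certificate costs polynomially** (JSS contraction in the `2n × 2n` arc variables):
if `h = x^M · h₂` then `L₊(NN_n · h₂) ≤ 16((2n+1)(L₊(NN_n · h)+1))²` and `L₊(h₂) ≤ 16((2n+1)(L₊(h)+1))²`.
[cite: JuknaSeiwertSergeev2022, Thm 1] -/
theorem complexity_strip_le (n : ℕ) {h h₂ : MvPolynomial (Fin (2 * n) × Fin (2 * n)) ℝ≥0}
    {M : (Fin (2 * n) × Fin (2 * n)) →₀ ℕ} (hM : monomial M 1 * h₂ = h) :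
    complexity (nestFreeMatchingPoly n ℝ≥0 * h₂) ≤
        16 * ((2 * n + 1) * (complexity (nestFreeMatchingPoly n ℝ≥0 * h) + 1)) ^ 2 ∧
      complexity h₂ ≤ 16 * ((2 * n + 1) * (complexity h + 1)) ^ 2 := by
  constructor
  · have h1 := complexity_le_of_monomial_mul (2 * n) M (nestFreeMatchingPoly n ℝ≥0 * h₂)
    have heq : monomial M 1 * (nestFreeMatchingPoly n ℝ≥0 * h₂) = nestFreeMatchingPoly n ℝ≥0 * h := by
      rw [← hM]; ring
    rw [heq] at h1
    exact h1
  · have h1 := complexity_le_of_monomial_mul (2 * n) M h₂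
    rw [hM] at h1
    exact h1

/-- the absorption arithmetic: `32 ((2n+1)(T+1))² ≤ 2^(2(ℓ+c)^c + 2ℓ + 11)` for `T = 2^((ℓ+c)^c)`, `ℓ = log₂ n`. -/
theorem strip_arith (n c : ℕ) :
    32 * ((2 * n + 1) * (2 ^ ((Nat.log 2 n + c) ^ c) + 1)) ^ 2 ≤
      2 ^ (2 * (Nat.log 2 n + c) ^ c + 2 * Nat.log 2 n + 11) := by
  set ℓ := Nat.log 2 n with hℓ
  set E := (ℓ + c) ^ c with hE
  have hn : n < 2 ^ (ℓ + 1) := Nat.lt_pow_succ_log_self Nat.one_lt_two n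
  have h1 : 2 * n + 1 ≤ 2 ^ (ℓ + 2) := by rw [pow_succ]; omega
  have h2 : 2 ^ E + 1 ≤ 2 ^ (E + 1) := by rw [pow_succ]; have := Nat.one_le_two_pow (n := E); omega
  have h3 : (2 * n + 1) * (2 ^ E + 1) ≤ 2 ^ (ℓ + 2) * 2 ^ (E + 1) := Nat.mul_le_mul h1 h2
  calc 32 * ((2 * n + 1) * (2 ^ E + 1)) ^ 2 ≤ 32 * (2 ^ (ℓ + 2) * 2 ^ (E + 1)) ^ 2 :=
        Nat.mul_le_mul_left 32 (Nat.pow_le_pow_left h3 2)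
    _ = 2 ^ (2 * E + 2 * ℓ + 11) := by
        rw [← pow_add, ← pow_mul, show (32 : ℕ) = 2 ^ 5 by norm_num, ← pow_add]
        congr 1; ring

/-- ★ **`NNDivisionHard` ⟺ its CONTENT-FREE tier.**  The crux holds iff, for every `c`, eventually in `n`, every nonzero
CONTENT-FREE cofactor `h` (every arc variable is missed by some monomial of `h`) has `2^((log₂ n + c)^c) < L₊(NN_n·h) + L₊(h)`:
a certificate with content is stripped (`exists_content_split`, `complexity_strip_le`) at polynomial cost, absorbed into the
quasi-polynomial threshold (`qp_absorb`, `strip_arith`). [cite: JuknaSeiwertSergeev2022, Thm 1] -/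
theorem nnDivisionHard_iff_contentFreeTier :
    Summit.ValiantsHypothesis.ValiantsHypothesis.Theses.FifoMatching.NNDivisionHard ↔
    ∀ c : ℕ, ∃ n₀ : ℕ, ∀ n ≥ n₀, ∀ h : MvPolynomial (Fin (2 * n) × Fin (2 * n)) ℝ≥0, h ≠ 0 →
      (∀ v : Fin (2 * n) × Fin (2 * n), ∃ d ∈ h.support, d v = 0) →
        2 ^ ((Nat.log 2 n + c) ^ c) < complexity (nestFreeMatchingPoly n ℝ≥0 * h) + complexity h := by
  constructor
  · intro H c
    obtain ⟨n₀, hn₀⟩ := H c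
    exact ⟨n₀, fun n hn h hh _ => hn₀ n hn h hh⟩
  · intro H c
    obtain ⟨C, hC⟩ := qp_absorb c 11
    obtain ⟨n₀, hn₀⟩ := H C
    refine ⟨n₀, fun n hn h hh => ?_⟩
    show 2 ^ ((Nat.log 2 n + c) ^ c) < complexity (nestFreeMatchingPoly n ℝ≥0 * h) + complexity h
    by_contra hle
    push Not at hle
    -- strip the content
    obtain ⟨M, h₂, hM, hfree, -⟩ := exists_content_split h hh
    have hh₂ : h₂ ≠ 0 := by rintro rfl; exact hh (by rw [← hM, mul_zero])
    obtain ⟨hs1, hs2⟩ := complexity_strip_le n hM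
    have hb1 : complexity (nestFreeMatchingPoly n ℝ≥0 * h) ≤ 2 ^ ((Nat.log 2 n + c) ^ c) :=
      le_trans (Nat.le_add_right _ _) hle
    have hb2 : complexity h ≤ 2 ^ ((Nat.log 2 n + c) ^ c) := le_trans (Nat.le_add_left _ _) hle
    have e1 : 16 * ((2 * n + 1) * (complexity (nestFreeMatchingPoly n ℝ≥0 * h) + 1)) ^ 2 ≤
        16 * ((2 * n + 1) * (2 ^ ((Nat.log 2 n + c) ^ c) + 1)) ^ 2 :=
      Nat.mul_le_mul_left 16 (Nat.pow_le_pow_left (Nat.mul_le_mul_left _ (by omega)) 2)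
    have e2 : 16 * ((2 * n + 1) * (complexity h + 1)) ^ 2 ≤
        16 * ((2 * n + 1) * (2 ^ ((Nat.log 2 n + c) ^ c) + 1)) ^ 2 :=
      Nat.mul_le_mul_left 16 (Nat.pow_le_pow_left (Nat.mul_le_mul_left _ (by omega)) 2)
    -- absorb
    have hexp : 2 * (Nat.log 2 n + c) ^ c + 2 * Nat.log 2 n + 11 ≤ (Nat.log 2 n + C) ^ C := by
      have h1 := hC (Nat.log 2 n)
      have hb2' : 2 * (Nat.log 2 n + (Nat.log 2 n + c) ^ c + 11) ≤
          (Nat.log 2 n + (Nat.log 2 n + c) ^ c + 11) ^ 11 :=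
        calc 2 * (Nat.log 2 n + (Nat.log 2 n + c) ^ c + 11)
            ≤ (Nat.log 2 n + (Nat.log 2 n + c) ^ c + 11) * (Nat.log 2 n + (Nat.log 2 n + c) ^ c + 11) :=
              Nat.mul_le_mul_right _ (by omega)
          _ = (Nat.log 2 n + (Nat.log 2 n + c) ^ c + 11) ^ 2 := (pow_two _).symm
          _ ≤ (Nat.log 2 n + (Nat.log 2 n + c) ^ c + 11) ^ 11 := Nat.pow_le_pow_right (by omega) (by norm_num)
      omega
    have habs : 32 * ((2 * n + 1) * (2 ^ ((Nat.log 2 n + c) ^ c) + 1)) ^ 2 ≤ 2 ^ ((Nat.log 2 n + C) ^ C) :=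
      (strip_arith n c).trans (Nat.pow_le_pow_right (by norm_num) hexp)
    -- contradict the tier at `C`
    have htier := hn₀ n hn h₂ hh₂ hfree
    have hfin : complexity (nestFreeMatchingPoly n ℝ≥0 * h₂) + complexity h₂ ≤ 2 ^ ((Nat.log 2 n + C) ^ C) :=
      le_trans (Nat.add_le_add (hs1.trans e1) (hs2.trans e2)) (le_trans (by omega) habs)
    exact absurd htier (not_lt.2 hfin)

end Summit.ValiantsHypothesis.ValiantsHypothesis.Theorems.FifoMatching.NNDivisionHard.ContentFree

end
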